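/-
Copyright (c) 2026 the pub-hodgecm-mathlib formalisation cell (harness21).  Prover seat hodgecm-mathlib-K2E5-p03 (g2),
Track B «K2-LIT» ∕ h413 (stmt-HodgeConjecture-24833), line K2_E5 «TamagawaUnitary», unit G «ZETA ∕ DESCENT», road of socket G7 `Zeta.sig_K2E5QuatUnitsBetaExists`
(the ONE hypothesis of ★ `K2E5QuatUnitsBetaExists.exists_quatUnitsPin`): UNIMODULARITY of `D^{(1)}_{h,𝔸}` and of `(D_h ⊗ 𝔸)^×`.
2026-09-03.
-/
import Summits.HodgeConjecture.HodgeConjecture.Theorems.K2E5QuatUnitsOneCocompact          -- ★ G1′ (K2E5-p03, p855765): `quatUnitsOneCocompact` (Fujisaki)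
import Summits.HodgeConjecture.HodgeConjecture.Theorems.K2E5HaarUnimodularOfFiniteCovolume -- ★ A6 (K2E5): `haarUnimodularOfFiniteCovolume`
import Literature.NumberTheory.Automorphic.GLnAdelicLocallyCompact                          -- ★ `AdelicGroupData.locallyCompactSpace_generalLinearGroup_adeleRing`
import Literature.NumberTheory.Automorphic.AdelicSecondCountable                            -- ★ `secondCountableTopology_generalLinearGroup_adeleRing`
import Mathlib.Topology.Algebra.GroupWithZero                                               -- `unitsHomeomorphNeZero`
import HarnessLib

/-!
# K2 ∕ E5 «TamagawaUnitary» — unit G, file `K2E5QuatUnitsUnimodular`: `D^{(1)}_{h,𝔸}` and `(D_h ⊗ 𝔸)^×` are UNIMODULAR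

Cell `hodgecm-mathlib` (Track B «K2-LIT»), engine E5, item h413 = `stmt-HodgeConjecture-24833` (`--supports … --as helper`).  Offer BY NAME to K2E5-plan (g2)
(2026-09-03T23:45:30Z, «G7a»; K2E5-p10's G7 sizing note 23:41:24Z route (ii)): socket G7 `Zeta.sig_K2E5QuatUnitsBetaExists` is ★ `K2E5QuatUnitsBetaExists.exists_quatUnitsPin`
(K2E5-p12, p855683) MODULO a two-sided Haar witness `(μ₀ : Measure ↥(quatAdelicUnits L h)) [μ₀.IsHaarMeasure] [μ₀.IsMulRightInvariant]` — the UNIMODULARITY of the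
adelic units of the quaternion algebra `D_h`.  THIS FILE supplies it (and the two-sided Haar measure on `D^{(1)}_{h,𝔸}` that G3∕G0D's `dx1` binders want):

* §1 **`D^{(1)}_{h,𝔸}` IS UNIMODULAR** (`exists_isHaarMeasure_isMulRightInvariant_quatAdelicUnitsOne`): it carries the lattice `Γ_h` (★ #3j: discrete, closed, countable)
  with COMPACT quotient (★ G1′ `quatUnitsOneCocompact`, FUJISAKI — anisotropy used here), so a right Haar measure (`Measure.haar.inv`) has a quotient of FINITE total
  mass (★ `regular_quotientMeasure`) and is therefore LEFT-invariant too by ★ A6 `haarUnimodularOfFiniteCovolume` («a group with a lattice of finite covolume is unimodular»).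
* §2 **THE CENTRAL SPLITTING** `(D_h ⊗ 𝔸)^× ≃ D^{(1)}_{h,𝔸} × ℝ_{>0}`, `x ↦ (x · θ(‖x‖)⁻¹, ‖x‖)`, inverse `(y, t) ↦ y · θ(t)` (★ #3j-bis `quatModuleSection` is a CENTRAL section of
  the module ★ `quatModuleUnits`): a MULTIPLICATIVE, bi-continuous bijection — multiplicative BECAUSE `θ` is central.
* §3 **`(D_h ⊗ 𝔸)^×` IS UNIMODULAR** (`exists_isHaarMeasure_isMulRightInvariant`): transport of `μ¹ ⊗ τ` (τ any Haar measure on the commutative `ℝ_{>0} = ℝ≥0ˣ`, locally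
  compact as the open subset `{t ≠ 0}` of `ℝ≥0`, Mathlib `unitsHomeomorphNeZero`) along the splitting: Haar (Mathlib `MulEquiv.isHaarMeasure_map`) and right-invariant.
Printed: [VignerasLNM800, Ch. III §2, proof of Thm. 2.2 («X_A^× ≅ X_{A,1} × ℝ₊ … mesures de Haar compatibles»)]; [WeilBNT1967, Ch. IV §4]; unimodularity of a group with a
lattice: [Raghunathan1972, Ch. I Remark 1.9] (★ A6's source).

HONEST LABEL: HC_CM is proved only modulo the 7 printed citations (2 remaining named inputs: hLiu418 = stmt-HodgeConjecture-24832,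
h413 = stmt-HodgeConjecture-24833) until rung 0 closes; this file is a `--supports stmt-HodgeConjecture-24833` helper (G7's hypothesis) and retires nothing by itself.

## References
* [VignerasLNM800] M.-F. Vignéras, *Arithmétique des algèbres de quaternions*, LNM 800 (1980), Ch. III §1 Thm. 1.4, §2 (proof of Thm. 2.2).
* [WeilBNT1967] A. Weil, *Basic Number Theory* (1967), Ch. IV §4.
* [Raghunathan1972] M. S. Raghunathan, *Discrete subgroups of Lie groups* (1972), Ch. I Remark 1.9.
-/

set_option autoImplicit false
-- the mandated namespace repeats the single-problem summit's segment (`HodgeConjecture.HodgeConjecture`)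
set_option linter.dupNamespace false

noncomputable section

namespace Summit.HodgeConjecture.HodgeConjecture.Cruxes.H413.K2E5QuatUnitsUnimodular

open MeasureTheory MeasureTheory.Measure NumberField IsDedekindDomain Topology
open Literature.MeasureTheory.Group
open Literature.NumberTheory.Automorphic
open Summit.HodgeConjecture.HodgeConjecture.Cruxes.H413.K2E5QuatAdelicMatrixModel
open Summit.HodgeConjecture.HodgeConjecture.Cruxes.H413.K2E5QuatAdelicLattice
open Summit.HodgeConjecture.HodgeConjecture.Cruxes.H413.K2E5QuatAdelicModuleOne
open scoped NNReal ENNReal Matrix MatrixGroups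

variable (L : Type) [Field L] [NumberField L] [IsCMField L] (Ha : Matrix (Fin 2) (Fin 2) L)

/-! ## §1 `D^{(1)}_{h,𝔸}` is unimodular -/

section UnitsOne

/-- **`D^{(1)}_{h,𝔸}` IS UNIMODULAR**: for an anisotropic hermitian plane `h` there is a Haar measure on `D^{(1)}_{h,𝔸} = ↥(quatAdelicUnitsOne L h)` which is also RIGHT invariant —
a right Haar measure has a quotient by the COCOMPACT lattice `Γ_h` (★ G1′) of finite total mass, hence is left invariant (★ A6 `haarUnimodularOfFiniteCovolume`).
[cite: VignerasLNM800, Ch. III §2 (proof of Thm. 2.2)] [cite: Raghunathan1972, Ch. I Remark 1.9] -/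
theorem exists_isHaarMeasure_isMulRightInvariant_quatAdelicUnitsOne (hHa : (Ha.map (cmConjRingHom L)).transpose = Ha)
    (han : ∀ v : Fin 2 → L, Literature.AlgebraicGeometry.ShimuraVarieties.hermForm (cmConjRingHom L) Ha v v = 0 → v = 0) (hdet : Ha.det ≠ 0)
    [MeasurableSpace (GL (Fin 2) (AdeleRing (𝓞 L) L))] [BorelSpace (GL (Fin 2) (AdeleRing (𝓞 L) L))] :
    ∃ μ : Measure ↥(quatAdelicUnitsOne L Ha), μ.IsHaarMeasure ∧ μ.IsMulRightInvariant := by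
  haveI : T2Space (AdeleRing (𝓞 L) L) := t2Space_adeleRing_of_numberField L
  haveI : LocallyCompactSpace (GL (Fin 2) (AdeleRing (𝓞 L) L)) := AdelicGroupData.locallyCompactSpace_generalLinearGroup_adeleRing L (Fin 2)
  haveI : SecondCountableTopology (GL (Fin 2) (AdeleRing (𝓞 L) L)) := secondCountableTopology_generalLinearGroup_adeleRing L (Fin 2)
  haveI : LocallyCompactSpace ↥(quatAdelicUnits L Ha) := (isClosed_quatAdelicUnits L Ha).isClosedEmbedding_subtypeVal.locallyCompactSpace
  haveI : LocallyCompactSpace ↥(quatAdelicUnitsOne L Ha) := (isClosed_quatAdelicUnitsOne L Ha).isClosedEmbedding_subtypeVal.locallyCompactSpace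
  haveI := discreteTopology_quatRatLatticeOne L Ha
  haveI := countable_quatRatLatticeOne L Ha
  haveI : (count : Measure ↥(quatRatLatticeOne L Ha)).IsHaarMeasure := isHaarMeasure_count_of_discrete
  letI : MeasurableSpace (↥(quatAdelicUnitsOne L Ha) ⧸ quatRatLatticeOne L Ha) := borel _
  haveI : BorelSpace (↥(quatAdelicUnitsOne L Ha) ⧸ quatRatLatticeOne L Ha) := ⟨rfl⟩
  haveI : CompactSpace (↥(quatAdelicUnitsOne L Ha) ⧸ quatRatLatticeOne L Ha) :=
    K2E5QuatUnitsOneCocompact.quatUnitsOneCocompact L Ha hHa han hdet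
  -- a RIGHT Haar measure: the inverse of Mathlib's left Haar measure
  set μ : Measure ↥(quatAdelicUnitsOne L Ha) := (haar : Measure ↥(quatAdelicUnitsOne L Ha)).inv with hμ
  have hfin : quotientMeasure (quatRatLatticeOne L Ha) (count : Measure ↥(quatRatLatticeOne L Ha)) (isClosed_quatRatLatticeOne L Ha) μ Set.univ < ∞ :=
    IsCompact.measure_lt_top isCompact_univ
  have hleft : μ.IsMulLeftInvariant :=
    K2E5HaarUnimodularOfFiniteCovolume.haarUnimodularOfFiniteCovolume (quatRatLatticeOne L Ha) (isClosed_quatRatLatticeOne L Ha) μ hfin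
  exact ⟨μ, { toIsFiniteMeasureOnCompacts := inferInstance, toIsMulLeftInvariant := hleft, toIsOpenPosMeasure := inferInstance }, inferInstance⟩

end UnitsOne

/-! ## §2 The positive reals `ℝ≥0ˣ` as a locally compact second-countable group -/

section PosReal

/-- The inclusion `ℝ≥0ˣ → ℝ≥0` is an OPEN embedding (units of a `T₁` group with zero with continuous inversion = the open set `{t ≠ 0}`). [folklore] -/
theorem isOpenEmbedding_nnrealUnits_val : IsOpenEmbedding (Units.val : ℝ≥0ˣ → ℝ≥0) := by
  refine ⟨Units.isEmbedding_val₀, ?_⟩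
  have h : Set.range (Units.val : ℝ≥0ˣ → ℝ≥0) = {t | t ≠ 0} := by
    ext t
    simp only [Set.mem_range, Set.mem_setOf_eq, ← isUnit_iff_ne_zero, IsUnit]
  rw [h]
  exact isOpen_ne

/-- `ℝ_{>0} = ℝ≥0ˣ` is locally compact. [folklore] -/
theorem locallyCompactSpace_nnrealUnits : LocallyCompactSpace ℝ≥0ˣ :=
  isOpenEmbedding_nnrealUnits_val.locallyCompactSpace

/-- `ℝ≥0ˣ` is second countable. [folklore] -/
theorem secondCountableTopology_nnrealUnits : SecondCountableTopology ℝ≥0ˣ :=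
  Units.isEmbedding_val₀.secondCountableTopology

end PosReal

/-! ## §3 The central splitting and the unimodularity of `(D_h ⊗ 𝔸)^×` -/

section Units

/-- The first component of the splitting is multiplicative: `xy · θ(‖xy‖)⁻¹ = (x θ(‖x‖)⁻¹)(y θ(‖y‖)⁻¹)` — BECAUSE `θ` is central (★ `quatModuleSection_mul_comm`). [folklore] -/
theorem splitting_fst_mul (x y : ↥(quatAdelicUnits L Ha)) :
    x * y * (quatModuleSection L Ha (quatModuleUnits L Ha (x * y)))⁻¹ =
      x * (quatModuleSection L Ha (quatModuleUnits L Ha x))⁻¹ * (y * (quatModuleSection L Ha (quatModuleUnits L Ha y))⁻¹) := by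
  have key : ∀ c d : ↥(quatAdelicUnits L Ha), (∀ z, c * z = z * c) → x * c * (y * d) = x * y * (c * d) := by
    intro c d hcc
    rw [mul_assoc x c, ← mul_assoc c y d, hcc y, mul_assoc y c d, ← mul_assoc x y]
  rw [map_mul (quatModuleUnits L Ha), ← map_inv (quatModuleSection L Ha), ← map_inv (quatModuleSection L Ha),
    ← map_inv (quatModuleSection L Ha), mul_inv, map_mul (quatModuleSection L Ha)]
  exact (key _ _ (quatModuleSection_mul_comm L Ha _)).symm

/-- The module of `y · θ(t)` is `t` for `y ∈ D^{(1)}`. [folklore] -/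
theorem quatModuleUnits_mul_section {y : ↥(quatAdelicUnits L Ha)} (hy : y ∈ quatAdelicUnitsOne L Ha) (t : ℝ≥0ˣ) :
    quatModuleUnits L Ha (y * quatModuleSection L Ha t) = t := by
  have hmy : quatModuleUnits L Ha y = 1 := by
    rw [quatAdelicUnitsOne_eq_ker_quatModuleUnits] at hy
    exact hy
  rw [map_mul, hmy, one_mul, quatModuleUnits_quatModuleSection]

/-- **`(D_h ⊗ 𝔸)^×` IS UNIMODULAR**: for an anisotropic hermitian plane `h` there is a Haar measure on `(D_h ⊗ 𝔸)^× = ↥(quatAdelicUnits L h)` which is also RIGHT invariant — the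
hypothesis `μ₀` of ★ `K2E5QuatUnitsBetaExists.exists_quatUnitsPin` (socket G7).  Proof: the CENTRAL SPLITTING `x ↦ (x·θ(‖x‖)⁻¹, ‖x‖) : (D_h ⊗ 𝔸)^× ≃ D^{(1)}_{h,𝔸} × ℝ_{>0}`
(multiplicative because ★ #3j-bis `quatModuleSection` is central, bi-continuous) transports `μ¹ ⊗ τ` (§1 and any Haar measure of the commutative `ℝ_{>0}`), a Haar and
right-invariant measure on the product. [cite: VignerasLNM800, Ch. III §2 (proof of Thm. 2.2)] [cite: WeilBNT1967, Ch. IV §4] -/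
theorem exists_isHaarMeasure_isMulRightInvariant (hHa : (Ha.map (cmConjRingHom L)).transpose = Ha)
    (han : ∀ v : Fin 2 → L, Literature.AlgebraicGeometry.ShimuraVarieties.hermForm (cmConjRingHom L) Ha v v = 0 → v = 0) (hdet : Ha.det ≠ 0)
    [MeasurableSpace (GL (Fin 2) (AdeleRing (𝓞 L) L))] [BorelSpace (GL (Fin 2) (AdeleRing (𝓞 L) L))] :
    ∃ μ₀ : Measure ↥(quatAdelicUnits L Ha), μ₀.IsHaarMeasure ∧ μ₀.IsMulRightInvariant := by
  haveI : T2Space (AdeleRing (𝓞 L) L) := t2Space_adeleRing_of_numberField L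
  haveI : LocallyCompactSpace (GL (Fin 2) (AdeleRing (𝓞 L) L)) := AdelicGroupData.locallyCompactSpace_generalLinearGroup_adeleRing L (Fin 2)
  haveI : SecondCountableTopology (GL (Fin 2) (AdeleRing (𝓞 L) L)) := secondCountableTopology_generalLinearGroup_adeleRing L (Fin 2)
  haveI : LocallyCompactSpace ↥(quatAdelicUnits L Ha) := (isClosed_quatAdelicUnits L Ha).isClosedEmbedding_subtypeVal.locallyCompactSpace
  haveI : LocallyCompactSpace ↥(quatAdelicUnitsOne L Ha) := (isClosed_quatAdelicUnitsOne L Ha).isClosedEmbedding_subtypeVal.locallyCompactSpace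
  obtain ⟨μ1, hμ1, hμ1r⟩ := exists_isHaarMeasure_isMulRightInvariant_quatAdelicUnitsOne L Ha hHa han hdet
  -- the positive reals
  letI : MeasurableSpace ℝ≥0ˣ := borel ℝ≥0ˣ
  haveI : BorelSpace ℝ≥0ˣ := ⟨rfl⟩
  haveI := locallyCompactSpace_nnrealUnits
  haveI := secondCountableTopology_nnrealUnits
  set τ : Measure ℝ≥0ˣ := haar with hτ
  haveI : τ.IsMulRightInvariant := ⟨fun t => by
    rw [show (fun s : ℝ≥0ˣ => s * t) = fun s => t * s from funext fun s => mul_comm s t]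
    exact map_mul_left_eq_self τ t⟩
  -- the central splitting `e : (D_h ⊗ 𝔸)^× ≃* D^{(1)} × ℝ≥0ˣ`
  haveI := hμ1
  haveI := hμ1r
  let f : ↥(quatAdelicUnits L Ha) → ↥(quatAdelicUnitsOne L Ha) × ℝ≥0ˣ := fun x =>
    (⟨x * (quatModuleSection L Ha (quatModuleUnits L Ha x))⁻¹, mul_quatModuleSection_inv_mem_quatAdelicUnitsOne L Ha x⟩, quatModuleUnits L Ha x)
  let g : ↥(quatAdelicUnitsOne L Ha) × ℝ≥0ˣ → ↥(quatAdelicUnits L Ha) := fun p =>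
    (p.1 : ↥(quatAdelicUnits L Ha)) * quatModuleSection L Ha p.2
  have hgf : Function.LeftInverse g f := fun x => inv_mul_cancel_right x _
  have hfg : Function.RightInverse g f := fun p => by
    have hm : quatModuleUnits L Ha ((p.1 : ↥(quatAdelicUnits L Ha)) * quatModuleSection L Ha p.2) = p.2 :=
      quatModuleUnits_mul_section L Ha p.1.2 p.2
    refine Prod.ext (Subtype.ext ?_) hm
    show (p.1 : ↥(quatAdelicUnits L Ha)) * quatModuleSection L Ha p.2 *
        (quatModuleSection L Ha (quatModuleUnits L Ha ((p.1 : ↥(quatAdelicUnits L Ha)) * quatModuleSection L Ha p.2)))⁻¹ = p.1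
    rw [hm, mul_inv_cancel_right]
  let e : ↥(quatAdelicUnits L Ha) ≃* ↥(quatAdelicUnitsOne L Ha) × ℝ≥0ˣ :=
    { toFun := f, invFun := g, left_inv := hgf, right_inv := hfg,
      map_mul' := fun x y => Prod.ext (Subtype.ext (splitting_fst_mul L Ha x y)) (map_mul (quatModuleUnits L Ha) x y) }
  have he : Continuous e := by
    refine Continuous.prodMk ?_ (continuous_quatModuleUnits L Ha)
    exact (continuous_id.mul ((continuous_quatModuleSection L Ha).comp (continuous_quatModuleUnits L Ha)).inv).subtype_mk _
  have hes : Continuous e.symm :=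
    (continuous_subtype_val.comp continuous_fst).mul ((continuous_quatModuleSection L Ha).comp continuous_snd)
  refine ⟨Measure.map e.symm (μ1.prod τ), e.symm.isHaarMeasure_map (μ1.prod τ) hes he, ⟨fun g => ?_⟩⟩
  rw [Measure.map_map (measurable_mul_const g) hes.measurable]
  have hcomp : ((fun x : ↥(quatAdelicUnits L Ha) => x * g) ∘ (e.symm : ↥(quatAdelicUnitsOne L Ha) × ℝ≥0ˣ → ↥(quatAdelicUnits L Ha))) =
      (e.symm : ↥(quatAdelicUnitsOne L Ha) × ℝ≥0ˣ → ↥(quatAdelicUnits L Ha)) ∘ fun p => p * e g := by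
    funext p
    simp only [Function.comp_apply, map_mul, MulEquiv.symm_apply_apply]
  rw [hcomp, ← Measure.map_map hes.measurable (measurable_mul_const _), map_mul_right_eq_self]

end Units

end Summit.HodgeConjecture.HodgeConjecture.Cruxes.H413.K2E5QuatUnitsUnimodular

end
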